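import Summits.HodgeConjecture.HodgeConjecture.Theorems.VHCAbelianSchemesRoadSplitWeilTensorAnchors
import Summits.HodgeConjecture.HodgeConjecture.Theorems.Ring2AbelianAllOneTensorWeilClassCarrierDefs
import Literature.AlgebraicGeometry.Andre1996.WeilLineTensorPencils
import Literature.AlgebraicGeometry.HodgeTheory.WeilClassesFieldOneClass
import Literature.AlgebraicGeometry.HodgeTheory.HodgeTypeOfFlatSections
import Literature.AlgebraicGeometry.HodgeTheory.TopDegreeClasses
import HarnessLib

/-!
# Road b02 (`VHCAbelianSchemesRoad`) × the André column — THE LINE ENGINE: ONE carried `E`-Weil class per tensor structure over ONE elliptic curve,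
# André's `E`-line of Weil sections and the one-class lemma give `HC_CM` and the split Weil classes of every CM field (route-free)

research route, not a corollary; conditional on HC_CM plus one named minimal statement.

PARTS AC-f / AD-a derived `HC_CM` and `AndreSplitWeilClasses` from the door and carriers for EVERY rational `E`-Weil class of EVERY CM-field structure at the
tensor points over ONE `E₀`. André's proof of Lemme 6.3.3 (p. 33 with a), p. 32) gives more than one section: `G = Res SU(V, φ)` fixes the `E`-line
`⋀^{2p}_E V` POINTWISE, so EVERY `E`-Weil class of the tensor fibre extends to a global section landing in the `E`-Weil line of the anchored variety, non-zero
to non-zero (Literature `Andre1996.IsWeilLineAt` / `IsWeilLineAnchoredPencilFor`, named facts `andre1996_splitWeilClasses_weilLinePencil`,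
`andre1996_cmHodgeClasses_weilLinePencils`; statement only, this generation). With the tree's ONE-CLASS LEMMA (`weilClassesField_le_algebraicClasses_of_
isRationalClass_of_ne_zero`: `E` acts by algebraic correspondences and `dim_E W_E = 1`, Markman §4 / Moonen–Zarhin §1) ONE carried class per tensor structure
suffices. This file proves, fact-free apart from the displayed named facts:

* §0 projections: the line predicate implies the tensor predicate; the line facts imply the tensor facts (hence everything of AC-f / AD-a–c);
* §1 `anchoredCarrierAt_carriedClasses`: for the served-class map `carriedClasses 𝒪 n p` («the classes that HAVE an `𝒪`-datum», PART AD-II Defs) the road's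
  `AnchoredCarrierAt 𝒪 n p 𝔄 (carriedClasses 𝒪 n p)` is a tautology — so the served-fibre engine runs on any class with a datum; the all-classes node gives data;
* §2 **THE LINE ENGINE** `weilClassesField_le_algebraicClasses_of_isWeilLineAnchoredPencilFor_of_door_of_oneCarried`: the door for `𝒪` ∧ a line-anchored pencil
  for `(B, η, w)` at `E₀` with `w ≠ 0` ∧ «at the tensor structure of its special fibre, GIVEN a non-zero rational `(p,p)` Weil witness, SOME non-zero rational
  Weil class is carried modulo the `θ`-ray» ⟹ **the whole `E`-line `W_E(B) ⊗ ℂ` is algebraic**. Proof: `W|_{s₁} ≠ 0` (it pulls back to `q·w`), hence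
  `W|_{s₀} ≠ 0` (a global class vanishing on one fibre of a smooth projective family over a connected base vanishes on all — `complexBetti_map_fiberι_eq_zero_
  of_eq_zero_at`), so `W|_{s₀}` is the witness; the carried class `w₁` extends (line clause) to `W'` with `W'|_{s₀} = w₁`; the pencil is served at `s₀` for
  `carriedClasses`, so the door makes `W'` algebraic on every fibre; `γ := g'^*(e₁^*(W'|_{s₁}))` is a non-zero rational algebraic class of `W_E(B)`; one-class lemma;
* §3 **`andreSplitWeil_of_weilLinePencil_of_door_of_oneCarried`** (every split datum, every CM field, every `p ≥ 1`; `p = 1` Lefschetz) and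
  **`cmHodgeHypothesisAt_of_weilLinePencils_of_door_of_oneCarried`** (`HC_CM`: each generator `g^*(w)` of 6.3.2 lies in an algebraic `E'`-line), both from the
  GUARDED one-class statement at all cells `2 ≤ p ≤ d − 2` over ONE `E₀`; twisted-door forms per `C`.

HONEST: the line facts are THEOREMS IN PRINT vendored as `Prop`s (from the proof of 6.3.3; «NOT recorded» lists in the Literature module); every carrier
statement is OPEN, not in print, NOT implied by the Hodge conjecture; the door is the road's binder (labels: route file, RING2-MAP AA2.487). The UNGUARDED node
`OneTensorWeilClassCarriers` over-asks at CM `E₀` (non-Weil-type structures; Defs file §2) and is not used here. Nothing here says any carrier, door, Weil class,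
`HC_CM`, `HC_AV` or HC holds. References: [cite: Andre1996Motifs, §6.3 a) (p. 32), b), Lemmes 6.3.2–6.3.3 and proof (pp. 32–33)] [cite: MoonenZarhin1998WeilClasses, §1]
[cite: Markman2025SurveySecant, §4] [cite: DeligneHodgeII1971, Cor. 4.1.2] [cite: Bloch1972Semiregularity, Remark (7.5)] [cite: BuchweitzFlenner2003, §5 Thm. 5.1]
[cite: Fulton1998, §19.2 Cor. 19.2 (b)] [cite: Milne1999, §7 p. 72].
-/

noncomputable section

open CategoryTheory CategoryTheory.Limits AlgebraicGeometry Topology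

namespace Summit.HodgeConjecture.HodgeConjecture.Ring2.SemiregularRepresentatives

-- the cell's namespace repeats the summit name (`Summit.HodgeConjecture.HodgeConjecture…`), as in every `Ring2*` file
set_option linter.dupNamespace false

open Literature.AlgebraicGeometry Literature.AlgebraicGeometry.Motives
open Literature.AlgebraicGeometry.HodgeTheory
open Literature.AlgebraicGeometry.Deligne1982
open Literature.AlgebraicGeometry.VanGeemen1994 (pullbackOne)
open Literature.AlgebraicTopology.SingularHomology
open Literature.Barriers.HodgeConjecture (divisorClassesSpan)
open Literature.AlgebraicGeometry.Andre1996 (andre1996_cmHodgeClasses_weilTensorPencils andre1996_splitWeilClasses_weilTensorPencil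
  andre1996_splitWeilClasses_weilLinePencil andre1996_cmHodgeClasses_weilLinePencils andre1996_cmAnchoredPencil IsWeilTensorAnchoredPencilFor
  IsWeilLineAnchoredPencilFor
  IsWeilLineAt compactPencil_dim_eq_of_iso compactPencil_smooth_base)
open Literature.AlgebraicGeometry.Milne1999 (IsOfCMType CMHodgeHypothesisAt)
open Summit.HodgeConjecture.HodgeConjecture.Ring2.Binders (exists_forall_isPolarizationClass_map_fiberι)
open Summit.Ventures.HSemireg (ObjClass LocalVariationalHodgeFor)
open Summit.HodgeConjecture.HodgeConjecture.Ring2.AbelianAll (ellipticPowerPolarisedAnchorOf weilStructureServedClasses carriedClasses)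

/-! ## §0 Projections: line ⟹ tensor -/

/-- The line-anchored pencil predicate implies the tensor-anchored one (forget the line clause). [cite: Andre1996Motifs, Lemme 6.3.3 (p. 33)] -/
theorem isWeilTensorAnchoredPencilFor_of_isWeilLineAnchoredPencilFor {E₀ B : AbelianVariety ℂ} {η : B ⟶ B} {R : Polynomial ℤ} {p : ℕ}
    {w : complexBetti B.X (2 * p)} {𝒳 S : SchemeOver ℂ} {f : 𝒳 ⟶ S} {d : ℕ} (h : IsWeilLineAnchoredPencilFor E₀ B η R p w f d) :
    IsWeilTensorAnchoredPencilFor E₀ B p w f d := by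
  obtain ⟨hf, s₁, s₀, W, A₁, e₁, g', q, hW, hq, hgw, halg, A₀, e₀, N, ψ₀, hiso, hbr⟩ := h
  refine ⟨hf, s₁, s₀, W, A₁, e₁, g', q, hW, hq, hgw, halg, A₀, e₀, N, ψ₀, hiso, ?_⟩
  rcases hbr with ⟨δ, hδ, hψ, hd, hmem, -⟩ | ⟨P, e', hPm, hPe, he', hPirr, hPψ, hd, hnr, hQ, hmem, -⟩
  · exact Or.inl ⟨δ, hδ, hψ, hd, hmem⟩
  · exact Or.inr ⟨P, e', hPm, hPe, he', hPirr, hPψ, hd, hnr, hQ, hmem⟩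

/-- The split line fact implies the split tensor fact (hence the literature seat's fact and all of PART AD-a–c). [cite: Andre1996Motifs, Lemme 6.3.3 (p. 33)] -/
theorem andre1996_splitWeilClasses_weilTensorPencil_of_weilLinePencil (h : andre1996_splitWeilClasses_weilLinePencil) :
    andre1996_splitWeilClasses_weilTensorPencil := by
  intro E₀ hE₀ R e₀ p hp n B η e a w hB ha hRos hsplit hw hwQ
  obtain ⟨𝒳, S, f, hf⟩ := h E₀ hE₀ R e₀ p hp n B η e a w hB ha hRos hsplit hw hwQ
  exact ⟨𝒳, S, f, fun j ↦ isWeilTensorAnchoredPencilFor_of_isWeilLineAnchoredPencilFor (hf j)⟩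

/-- The CM line fact implies the CM tensor fact (hence `HC_CM` rows of AC-f and binder #22). [cite: Andre1996Motifs, Lemmes 6.3.2–6.3.3 (pp. 32–33)] -/
theorem andre1996_cmHodgeClasses_weilTensorPencils_of_weilLinePencils (h : andre1996_cmHodgeClasses_weilLinePencils) :
    andre1996_cmHodgeClasses_weilTensorPencils := by
  intro E₀ hE₀ B hB hCM p hp c hc hpp
  refine Submodule.span_mono ?_ (h E₀ hE₀ B hB hCM p hp c hc hpp)
  rintro c' ⟨B', g, η', R', e₀', e', a', w, 𝒳, S, f, -, -, -, -, -, -, -, hf, rfl⟩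
  exact ⟨B', g, w, B'.dim, 𝒳, S, f, isWeilTensorAnchoredPencilFor_of_isWeilLineAnchoredPencilFor hf, rfl⟩

variable {𝒪 : ObjClass} {n p : ℕ}

/-! ## §1 The served-class map «has a datum» makes the anchored carrier statement a tautology -/

/-- For every anchor predicate `𝔄`: `AnchoredCarrierAt 𝒪 n p 𝔄 (carriedClasses 𝒪 n p)` (the served classes are, by definition, those with a datum).
[cite: Bloch1972Semiregularity, Remark (7.5)] -/
theorem anchoredCarrierAt_carriedClasses (𝔄 : ∀ X : SchemeOver ℂ, complexBetti X 2 → Prop) : AnchoredCarrierAt 𝒪 n p 𝔄 (carriedClasses 𝒪 n p) :=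
  fun _ _ _ _ hw _ ↦ hw

/-- Conversely a served rational class at an anchor IS carried: `AnchoredCarrierAt 𝒪 n p 𝔄 𝔖 → 𝔄 X θ → w ∈ 𝔖 X θ → IsRationalClass w → w ∈ carriedClasses 𝒪 n p X θ`.
[cite: Bloch1972Semiregularity, Remark (7.5)] -/
theorem mem_carriedClasses_of_anchoredCarrierAt {𝔄 : ∀ X : SchemeOver ℂ, complexBetti X 2 → Prop}
    {𝔖 : ∀ (X : SchemeOver ℂ), complexBetti X 2 → Set (complexBetti X (2 * p))} (h : AnchoredCarrierAt 𝒪 n p 𝔄 𝔖) {X : SchemeOver ℂ}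
    {θ : complexBetti X 2} (hX : 𝔄 X θ) {w : complexBetti X (2 * p)} (hw : w ∈ 𝔖 X θ) (hwQ : IsRationalClass w) :
    w ∈ carriedClasses 𝒪 n p X θ :=
  h X θ hX w hw hwQ

/-- **All classes ⟹ one class (guarded)**: the Weil-tensor carrier statement at `(n, p)` (a datum for EVERY rational `(p,p)` `E`-Weil class) gives the guarded
one-class statement at `(n, p)` — carry the witness itself. [cite: Bloch1972Semiregularity, Remark (7.5)] [cite: MoonenZarhin1998WeilClasses, §1] -/
theorem oneCarried_of_anchoredCarrierAt_weilStructureServed {E₀ : AbelianVariety ℂ}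
    (h : AnchoredCarrierAt 𝒪 n p (ellipticPowerPolarisedAnchorOf E₀ n) (weilStructureServedClasses n p))
    (X : SchemeOver ℂ) (θ : complexBetti X 2) (hθ : IsPolarizationClass n X θ) (A₀ : AbelianVariety ℂ) (e : A₀.X ≅ X) (N : ℕ) (ψ₀ : A₀ ⟶ A₀)
    (hd : A₀.dim = n) (hiso : A₀.IsIsogenous (E₀.powSucc N)) :
    (∀ δ : ℕ, 0 < δ → ψ₀ ≫ ψ₀ = -(δ • 𝟙 A₀) → n = 2 * p →
      (∃ w' : complexBetti X (2 * p), IsRationalClass w' ∧ w' ≠ 0 ∧ IsOfHodgeType n X (2 * p) p p w' ∧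
          complexBetti.map e.hom (2 * p) w' ∈ weilClassesOf A₀ ψ₀ p δ) →
        ∃ w : complexBetti X (2 * p), IsRationalClass w ∧ w ≠ 0 ∧
          complexBetti.map e.hom (2 * p) w ∈ weilClassesOf A₀ ψ₀ p δ ∧ w ∈ carriedClasses 𝒪 n p X θ) ∧
    (∀ (P : Polynomial ℤ) (e' : ℕ),
        P.Monic → P.natDegree = e' → 2 < e' → Irreducible (P.map (Int.castRingHom ℚ)) →
        Polynomial.eval₂ (Int.castRingHom (CategoryTheory.End A₀)) (ψ₀ : CategoryTheory.End A₀) P = 0 →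
        n = p * e' →
        (∀ ρ : ℂ, Polynomial.eval₂ (Int.castRingHom ℂ) ρ P = 0 → starRingEnd ℂ ρ ≠ ρ) →
        (∃ Q : Polynomial ℚ, ∀ ρ : ℂ, Polynomial.eval₂ (Int.castRingHom ℂ) ρ P = 0 →
            Polynomial.eval₂ (algebraMap ℚ ℂ) ρ Q = starRingEnd ℂ ρ) →
        (∃ w' : complexBetti X (2 * p), IsRationalClass w' ∧ w' ≠ 0 ∧ IsOfHodgeType n X (2 * p) p p w' ∧
            complexBetti.map e.hom (2 * p) w' ∈ weilClassesField A₀ ψ₀ P (2 * p)) →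
          ∃ w : complexBetti X (2 * p), IsRationalClass w ∧ w ≠ 0 ∧
            complexBetti.map e.hom (2 * p) w ∈ weilClassesField A₀ ψ₀ P (2 * p) ∧ w ∈ carriedClasses 𝒪 n p X θ) := by
  have hX : ellipticPowerPolarisedAnchorOf E₀ n X θ := ⟨⟨A₀, N, hd, hiso, ⟨e⟩⟩, hθ⟩
  refine ⟨fun δ hδ hψ hn ↦ ?_, fun P e' hPm hPe he' hPirr hPψ hn hnr hQ ↦ ?_⟩
  · rintro ⟨w', hw'Q, hw'0, hw'H, hw'W⟩
    exact ⟨w', hw'Q, hw'0, hw'W, mem_carriedClasses_of_anchoredCarrierAt h hX ⟨hw'H, A₀, e, ψ₀, Or.inl ⟨δ, hδ, hψ, hn, hw'W⟩⟩ hw'Q⟩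
  · rintro ⟨w', hw'Q, hw'0, hw'H, hw'W⟩
    exact ⟨w', hw'Q, hw'0, hw'W,
      mem_carriedClasses_of_anchoredCarrierAt h hX ⟨hw'H, A₀, e, ψ₀, Or.inr ⟨P, e', hPm, hPe, he', hPirr, hPψ, hn, hnr, hQ, hw'W⟩⟩ hw'Q⟩

/-! ## §2 THE LINE ENGINE -/

section Engine

variable {𝒳 S : SchemeOver ℂ} {f : 𝒳 ⟶ S}

/-- A served-anywhere class with a datum is algebraic on every fibre of a compact pencil: the road's served-fibre engine with the tautological served-class
map `carriedClasses`. [cite: BuchweitzFlenner2003, §5 Thm. 5.1] [cite: CharlesSchnell2014Notes, Prop. 11.3.11 (proof)] -/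
theorem mem_algebraicClasses_compactPencil_of_carried_at (hT : LocalVariationalHodgeFor 𝒪) (hf : IsCompactAbelianPencil f n) (W : complexBetti 𝒳 (2 * p))
    (hW : ∀ s : ComplexPoints S, IsRationalClass (complexBetti.map (fiberι f s) (2 * p) W) ∧
      IsOfHodgeType n (fiberOver f s) (2 * p) p p (complexBetti.map (fiberι f s) (2 * p) W))
    {s₀ : ComplexPoints S} {Θ : complexBetti 𝒳 2} (hΘ : ∀ s : ComplexPoints S, IsPolarizationClass n (fiberOver f s) (complexBetti.map (fiberι f s) 2 Θ))
    (hc : complexBetti.map (fiberι f s₀) (2 * p) W ∈ carriedClasses 𝒪 n p (fiberOver f s₀) (complexBetti.map (fiberι f s₀) 2 Θ))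
    (s : ComplexPoints S) : complexBetti.map (fiberι f s) (2 * p) W ∈ algebraicClasses (fiberOver f s) p :=
  mem_algebraicClasses_compactPencil_of_anchoredCarrierAt_of_hasServedFibre hT (anchoredCarrierAt_carriedClasses (𝒪 := 𝒪) fun _ _ ↦ True) hf W hW
    ⟨s₀, Θ, fun s ↦ (hΘ s).isRationalClass,
      fun s ↦ isOfHodgeType_of_mem_algebraicClasses_of_isSmoothProjective (hf.isSmoothProjectiveFamily.isSmoothProjective s) 1 (hΘ s).mem_algebraicClasses,
      trivial, hc⟩ s

variable {B : AbelianVariety ℂ} {η : B ⟶ B} {R : Polynomial ℤ} {e₀ : ℕ} {w : complexBetti B.X (2 * p)}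

/-- **THE LINE ENGINE.** The door for `𝒪`; a Weil-type CM datum `(B, η, R, e₀, p)`; a compact pencil `f` with `IsWeilLineAnchoredPencilFor E₀ B η R p w f B.dim`
for a NON-ZERO anchored class `w`; and, at the tensor structure `(A₀ ≅ X_{s₀}, ψ₀)` of its special fibre, the GUARDED one-class statement for the relative
polarisation («given a non-zero rational `(p,p)` Weil witness on `X_{s₀}`, SOME non-zero rational Weil class there is carried modulo the `θ`-ray») — here
asked in the blanket form «at every polarised `X ≅ A₀'` of dimension `dim B` isogenous to a power of `E₀`, every `ψ₀'`» — ⟹ **`W_E(B) ⊗ ℂ ≤ algebraicClasses B.X p`**.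
`W|_{s₁} ≠ 0` (it maps to `q·w ≠ 0`), so `W|_{s₀} ≠ 0` (flat: `complexBetti_map_fiberι_eq_zero_of_eq_zero_at`) is the witness; the carried `w₁` extends by the
LINE clause to `W'`; served at `s₀`, `W'` is algebraic everywhere; `γ = g'^*(e₁^*(W'|_{s₁})) ∈ W_E(B)` is rational, algebraic, non-zero; one-class lemma.
[cite: Andre1996Motifs, §6.3 a) (p. 32), Lemme 6.3.3 and proof (p. 33)] [cite: MoonenZarhin1998WeilClasses, §1] [cite: Markman2025SurveySecant, §4]
[cite: DeligneHodgeII1971, Cor. 4.1.2] [cite: BuchweitzFlenner2003, §5 Thm. 5.1] -/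
theorem weilClassesField_le_algebraicClasses_of_isWeilLineAnchoredPencilFor_of_door_of_oneCarried (hT : LocalVariationalHodgeFor 𝒪)
    {E₀ : AbelianVariety ℂ} (hB : IsWeilTypeCM B η R e₀ p) (hw0 : w ≠ 0) (hf : IsWeilLineAnchoredPencilFor E₀ B η R p w f B.dim)
    (hone : ∀ (X : SchemeOver ℂ) (θ : complexBetti X 2), IsPolarizationClass B.dim X θ →
      ∀ (A₀ : AbelianVariety ℂ) (e : A₀.X ≅ X) (N : ℕ) (ψ₀ : A₀ ⟶ A₀), A₀.dim = B.dim → A₀.IsIsogenous (E₀.powSucc N) →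
        (∀ δ : ℕ, 0 < δ → ψ₀ ≫ ψ₀ = -(δ • 𝟙 A₀) → B.dim = 2 * p →
          (∃ w' : complexBetti X (2 * p), IsRationalClass w' ∧ w' ≠ 0 ∧ IsOfHodgeType B.dim X (2 * p) p p w' ∧
              complexBetti.map e.hom (2 * p) w' ∈ weilClassesOf A₀ ψ₀ p δ) →
            ∃ w : complexBetti X (2 * p), IsRationalClass w ∧ w ≠ 0 ∧
              complexBetti.map e.hom (2 * p) w ∈ weilClassesOf A₀ ψ₀ p δ ∧ w ∈ carriedClasses 𝒪 B.dim p X θ) ∧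
        (∀ (P : Polynomial ℤ) (e' : ℕ),
            P.Monic → P.natDegree = e' → 2 < e' → Irreducible (P.map (Int.castRingHom ℚ)) →
            Polynomial.eval₂ (Int.castRingHom (CategoryTheory.End A₀)) (ψ₀ : CategoryTheory.End A₀) P = 0 →
            B.dim = p * e' →
            (∀ ρ : ℂ, Polynomial.eval₂ (Int.castRingHom ℂ) ρ P = 0 → starRingEnd ℂ ρ ≠ ρ) →
            (∃ Q : Polynomial ℚ, ∀ ρ : ℂ, Polynomial.eval₂ (Int.castRingHom ℂ) ρ P = 0 →
                Polynomial.eval₂ (algebraMap ℚ ℂ) ρ Q = starRingEnd ℂ ρ) →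
            (∃ w' : complexBetti X (2 * p), IsRationalClass w' ∧ w' ≠ 0 ∧ IsOfHodgeType B.dim X (2 * p) p p w' ∧
                complexBetti.map e.hom (2 * p) w' ∈ weilClassesField A₀ ψ₀ P (2 * p)) →
              ∃ w : complexBetti X (2 * p), IsRationalClass w ∧ w ≠ 0 ∧
                complexBetti.map e.hom (2 * p) w ∈ weilClassesField A₀ ψ₀ P (2 * p) ∧ w ∈ carriedClasses 𝒪 B.dim p X θ)) :
    weilClassesField B η (R.comp (Polynomial.X ^ 2)) (2 * p) ≤ algebraicClasses B.X p := by
  obtain ⟨hf, s₁, s₀, W, A₁, e₁, g', q, hW, hq, hgw, -, A₀, e₀', N, ψ₀, hiso, hbr⟩ := hf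
  -- the relative polarisation and the dimension of the special fibre
  haveI : IsSeparated S.hom :=
    (IsQuasiProjectiveOver.of_isProjectiveOver hf.isSmoothProjective_base.isProjectiveOver).isSeparated
  obtain ⟨Θ, hΘ⟩ := exists_forall_isPolarizationClass_map_fiberι f hf.isSmoothProjectiveFamily
    (IsQuasiProjectiveOver.of_isProjectiveOver hf.isSmoothProjective_total.isProjectiveOver)
  have hdA₀ : A₀.dim = B.dim := compactPencil_dim_eq_of_iso hf e₀'
  -- `W|_{s₁} ≠ 0`, hence `W|_{s₀} ≠ 0` (flat sections over the connected base)
  have hW₁ : complexBetti.map (fiberι f s₁) (2 * p) W ≠ 0 := by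
    intro h0
    apply hw0
    have h := hgw
    rw [h0, map_zero, map_zero] at h
    exact (smul_eq_zero_iff_right (Rat.cast_ne_zero.2 hq)).1 h.symm
  haveI : Smooth S.hom := compactPencil_smooth_base hf
  haveI : ConnectedSpace (ComplexPoints S) := connectedSpace_complexPoints hf.isSmoothProjective_base
  have hW₀ : complexBetti.map (fiberι f s₀) (2 * p) W ≠ 0 := fun h0 ↦
    hW₁ (complexBetti_map_fiberι_eq_zero_of_eq_zero_at f hf.isSmoothProjectiveFamily h0 s₁)
  -- the one-class lemma, fed by a non-zero rational algebraic class of `W_E(B)`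
  have her : 2 * e₀ * (2 * p) = 2 * B.dim := by rw [hB.dim_eq]; ring
  have key : ∀ W' : complexBetti 𝒳 (2 * p),
      (∀ s : ComplexPoints S, IsRationalClass (complexBetti.map (fiberι f s) (2 * p) W') ∧
        IsOfHodgeType B.dim (fiberOver f s) (2 * p) p p (complexBetti.map (fiberι f s) (2 * p) W')) →
      complexBetti.map (fiberι f s₀) (2 * p) W' ∈ carriedClasses 𝒪 B.dim p (fiberOver f s₀) (complexBetti.map (fiberι f s₀) 2 Θ) →
      complexBetti.map g'.hom.hom.hom (2 * p) (complexBetti.map e₁.hom (2 * p) (complexBetti.map (fiberι f s₁) (2 * p) W')) ∈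
        weilClassesField B η (R.comp (Polynomial.X ^ 2)) (2 * p) →
      complexBetti.map g'.hom.hom.hom (2 * p) (complexBetti.map e₁.hom (2 * p) (complexBetti.map (fiberι f s₁) (2 * p) W')) ≠ 0 →
      weilClassesField B η (R.comp (Polynomial.X ^ 2)) (2 * p) ≤ algebraicClasses B.X p := by
    intro W' hW' hc hγW hγ0
    have halg₁ : complexBetti.map (fiberι f s₁) (2 * p) W' ∈ algebraicClasses (fiberOver f s₁) p :=
      mem_algebraicClasses_compactPencil_of_carried_at hT hf W' hW' hΘ hc s₁
    have hγalg : complexBetti.map g'.hom.hom.hom (2 * p) (complexBetti.map e₁.hom (2 * p) (complexBetti.map (fiberι f s₁) (2 * p) W')) ∈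
        algebraicClasses B.X p :=
      map_mem_algebraicClasses_of_abelianVariety AbelianVariety.isSmoothProjective_holds A₁ g'.hom.hom.hom
        ((mem_algebraicClasses_map_iff_of_iso e₁).2 halg₁)
    have hγQ : IsRationalClass
        (complexBetti.map g'.hom.hom.hom (2 * p) (complexBetti.map e₁.hom (2 * p) (complexBetti.map (fiberι f s₁) (2 * p) W'))) :=
      (((hW' s₁).1.pullback _).pullback _)
    exact weilClassesField_le_algebraicClasses_of_isRationalClass_of_ne_zero hB.natDegree_comp hB.irreducible hB.eval₂_eq_zero her hB.k_pos
      hγW hγQ hγ0 hγalg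
  have hone₀ := hone (fiberOver f s₀) (complexBetti.map (fiberι f s₀) 2 Θ) (hΘ s₀) A₀ e₀' N ψ₀ hdA₀ hiso
  rcases hbr with ⟨δ, hδ, hψ, hd, hmem, hline⟩ | ⟨P, e', hPm, hPe, he', hPirr, hPψ, hd, hnr, hQ, hmem, hline⟩
  · obtain ⟨w₁, hw₁Q, hw₁0, hw₁W, hw₁c⟩ :=
      hone₀.1 δ hδ hψ hd ⟨complexBetti.map (fiberι f s₀) (2 * p) W, (hW s₀).1, hW₀, (hW s₀).2, hmem⟩
    obtain ⟨W', hW', hW's₀, hγW, hγne⟩ := hline w₁ hw₁W hw₁Q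
    exact key W' hW' (hW's₀ ▸ hw₁c) hγW (hγne hw₁0)
  · obtain ⟨w₁, hw₁Q, hw₁0, hw₁W, hw₁c⟩ :=
      hone₀.2 P e' hPm hPe he' hPirr hPψ hd hnr hQ ⟨complexBetti.map (fiberι f s₀) (2 * p) W, (hW s₀).1, hW₀, (hW s₀).2, hmem⟩
    obtain ⟨W', hW', hW's₀, hγW, hγne⟩ := hline w₁ hw₁W hw₁Q
    exact key W' hW' (hW's₀ ▸ hw₁c) hγW (hγne hw₁0)

end Engine

/-! ## §3 From the GUARDED node at all cells over ONE `E₀`: the split Weil classes of every CM field, and `HC_CM` -/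

section FromNode

open Summit.HodgeConjecture.HodgeConjecture.Ring2.AbelianAll (OneTensorWeilHodgeClassCarriers OneTensorWeilClassCarriers EllipticTensorWeilCarriers)

/-- Lattice: the all-classes node implies the guarded one-class node (carry the witness; §1). [cite: Bloch1972Semiregularity, Remark (7.5)] -/
theorem oneTensorWeilHodgeClassCarriers_of_ellipticTensorWeilCarriers {E₀ : AbelianVariety ℂ} (h : EllipticTensorWeilCarriers 𝒪 E₀) :
    OneTensorWeilHodgeClassCarriers 𝒪 E₀ :=
  fun n p h2 h4 X θ hθ A₀ e N ψ₀ hd hiso ↦ oneCarried_of_anchoredCarrierAt_weilStructureServed (h n p h2 h4) X θ hθ A₀ e N ψ₀ hd hiso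

/-- Lattice: the unguarded one-class node implies the guarded one (ignore the witness). [cite: Bloch1972Semiregularity, Remark (7.5)] -/
theorem oneTensorWeilHodgeClassCarriers_of_oneTensorWeilClassCarriers {E₀ : AbelianVariety ℂ} (h : OneTensorWeilClassCarriers 𝒪 E₀) :
    OneTensorWeilHodgeClassCarriers 𝒪 E₀ :=
  fun n p h2 h4 X θ hθ A₀ e N ψ₀ hd hiso ↦
    ⟨fun δ hδ hψ hn _ ↦ (h n p h2 h4 X θ hθ A₀ e N ψ₀ hd hiso).1 δ hδ hψ hn,
      fun P e' hPm hPe he' hPirr hPψ hn hnr hQ _ ↦ (h n p h2 h4 X θ hθ A₀ e N ψ₀ hd hiso).2 P e' hPm hPe he' hPirr hPψ hn hnr hQ⟩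

variable {B : AbelianVariety ℂ} {η : B ⟶ B} {R : Polynomial ℤ} {e₀ : ℕ}
  {e : ProjectiveEmbedding B.X} {a : complexBetti (projectiveSpace e.n ℂ) 2} {w : complexBetti B.X (2 * p)}

/-- Mid-range bookkeeping: `p + 2 ≤ dim B = 2p·e₀` for `p ≥ 2`. [folklore] -/
private theorem two_le_dim_of_isWeilTypeCM (hB : IsWeilTypeCM B η R e₀ p) (hp : 2 ≤ p) : p + 2 ≤ B.dim := by
  have h1 : 2 * p * 1 ≤ 2 * p * e₀ := Nat.mul_le_mul_left _ hB.e₀_pos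
  rw [hB.dim_eq]
  omega

/-- **SPLIT `E`-WEIL CLASSES, EVERY CM FIELD, EVERY `p ≥ 1`, FROM ONE CARRIED CLASS PER TENSOR STRUCTURE OVER ONE ELLIPTIC CURVE**: the split LINE fact ∧ the door
for `𝒪` ∧ `OneTensorWeilHodgeClassCarriers 𝒪 E₀` ⟹ every rational Weil class of every split `E`-Weil datum is algebraic (`p = 1`: Lefschetz via Moonen–Zarhin;
`p ≥ 2`: `w = 0` trivially, else the LINE engine of §2 on the fact's pencil for `(B, η, w)`). NO CM hypothesis on `B`; `HC_CM` absent.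
[cite: Andre1996Motifs, §6.3 a)–c) (pp. 32–33)] [cite: MoonenZarhin1998WeilClasses, §1] [cite: Markman2025SurveySecant, §4] [cite: Bloch1972Semiregularity, Remark (7.5)] -/
theorem splitWeilClass_mem_algebraicClasses_of_weilLinePencil_of_door_of_oneTensorWeilHodgeClassCarriers
    (h : andre1996_splitWeilClasses_weilLinePencil) (hT : LocalVariationalHodgeFor 𝒪) {E₀ : AbelianVariety ℂ} (hE₀ : E₀.dim = 1)
    (hone : OneTensorWeilHodgeClassCarriers 𝒪 E₀) (hB : IsWeilTypeCM B η R e₀ p) (ha : IsRationalClass a) (ha₀ : a ≠ 0)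
    (hRos : ∀ x y : complexBetti B.X 1,
      polarizationPairingOne B.X (complexBetti.map e.ι 2 a) (B.dim - 1) (pullbackOne B η x) y =
        -polarizationPairingOne B.X (complexBetti.map e.ι 2 a) (B.dim - 1) x (pullbackOne B η y))
    (hsplit : IsHyperbolicWeilType B η (p * e₀) (complexBetti.map e.ι 2 a))
    (hw : w ∈ weilClassesField B η (R.comp (Polynomial.X ^ 2)) (2 * p)) (hwQ : IsRationalClass w) :
    w ∈ algebraicClasses B.X p := by
  obtain _ | _ | p := p
  · exact absurd hB.k_pos (lt_irrefl 0)
  · exact lefschetzOneOne_rational_holds hB.isSmoothProjective w hwQ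
      (hB.isOfHodgeType_of_mem_weilClassesField MoonenZarhin1998_weilClasses_hodgeCriterion_holds hw)
  · by_cases hw0 : w = 0
    · rw [hw0]; exact zero_mem _
    obtain ⟨𝒳, S, f, hf⟩ := h E₀ hE₀ R e₀ (p + 2) (by omega) 1 (fun _ => B) (fun _ => η) (fun _ => e) (fun _ => a)
      (fun _ => w) (fun _ => hB) (fun _ => ⟨ha, ha₀⟩) (fun _ => hRos) (fun _ => hsplit) (fun _ => hw) (fun _ => hwQ)
    exact weilClassesField_le_algebraicClasses_of_isWeilLineAnchoredPencilFor_of_door_of_oneCarried hT hB hw0 (hf 0)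
      (fun X θ hθ A₀ e' N ψ₀ hd hiso ↦ hone B.dim (p + 2) (by omega) (two_le_dim_of_isWeilTypeCM hB (by omega)) X θ hθ A₀ e' N ψ₀ hd hiso) hw

/-- **The whole line, from the guarded node**: `W_E(B) ⊗ ℂ ≤ algebraicClasses B.X p` for every split datum. [cite: MoonenZarhin1998WeilClasses, §1 Lemma (1)]
[cite: Andre1996Motifs, §6.3 c) (p. 33)] -/
theorem weilClassesField_le_algebraicClasses_of_split_of_weilLinePencil_of_door_of_oneTensorWeilHodgeClassCarriers
    (h : andre1996_splitWeilClasses_weilLinePencil) (hT : LocalVariationalHodgeFor 𝒪) {E₀ : AbelianVariety ℂ} (hE₀ : E₀.dim = 1)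
    (hone : OneTensorWeilHodgeClassCarriers 𝒪 E₀) (hB : IsWeilTypeCM B η R e₀ p) (ha : IsRationalClass a) (ha₀ : a ≠ 0)
    (hRos : ∀ x y : complexBetti B.X 1,
      polarizationPairingOne B.X (complexBetti.map e.ι 2 a) (B.dim - 1) (pullbackOne B η x) y =
        -polarizationPairingOne B.X (complexBetti.map e.ι 2 a) (B.dim - 1) x (pullbackOne B η y))
    (hsplit : IsHyperbolicWeilType B η (p * e₀) (complexBetti.map e.ι 2 a)) :
    weilClassesField B η (R.comp (Polynomial.X ^ 2)) (2 * p) ≤ algebraicClasses B.X p :=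
  hB.weilClassesField_le_algebraicClasses_of_forall_isRationalClass fun _ hc hcQ ↦
    splitWeilClass_mem_algebraicClasses_of_weilLinePencil_of_door_of_oneTensorWeilHodgeClassCarriers h hT hE₀ hone hB ha ha₀ hRos hsplit hc hcQ

/-- **`HC_CM` FROM ONE CARRIED CLASS PER TENSOR STRUCTURE OVER ONE ELLIPTIC CURVE**: the CM LINE fact (Lemmes 6.3.2 + 6.3.3, targets exposed as split Weil-type CM
data, pencils in line form) ∧ the door for `𝒪` ∧ `OneTensorWeilHodgeClassCarriers 𝒪 E₀` ⟹ `CMHodgeHypothesisAt B` for every `B`: codimension `≤ 1` Lefschetz;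
`p ≥ 2`: each generator `g^*(w)` has `w` in the `E'`-line `W_{E'}(B')`, algebraic by the LINE engine (or `w = 0`).
[cite: Andre1996Motifs, §6.3 Lemmes 6.3.2–6.3.3 and proof (pp. 32–33)] [cite: MoonenZarhin1998WeilClasses, §1] [cite: Milne1999, §7 p. 72]
[cite: Bloch1972Semiregularity, Remark (7.5)] -/
theorem cmHodgeHypothesisAt_of_weilLinePencils_of_door_of_oneTensorWeilHodgeClassCarriers (h₂₂ : andre1996_cmHodgeClasses_weilLinePencils)
    (hT : LocalVariationalHodgeFor 𝒪) {E₀ : AbelianVariety ℂ} (hE₀ : E₀.dim = 1) (hone : OneTensorWeilHodgeClassCarriers 𝒪 E₀)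
    (B : AbelianVariety ℂ) : CMHodgeHypothesisAt B := by
  intro hB hCM
  refine (hodgeConjectureFor_iff_of_isSmoothProjective nonempty_hodgeModel_holds hB).2 ?_
  intro p c hc hpp
  by_cases hp : p ≤ 1
  · exact (mem_algebraicClasses_and_divisorClassesSpan_of_offMidRange hB (Or.inl hp) c hc hpp).1
  refine (Submodule.span_le.mpr ?_) (h₂₂ E₀ hE₀ B hB hCM p (by omega) c hc hpp)
  rintro _ ⟨B', g, η', R', e₀', e', a', w, 𝒳, S, f, hB', -, -, -, -, hw, -, hf, rfl⟩
  have hw_alg : w ∈ algebraicClasses B'.X p := by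
    by_cases hw0 : w = 0
    · rw [hw0]; exact zero_mem _
    exact weilClassesField_le_algebraicClasses_of_isWeilLineAnchoredPencilFor_of_door_of_oneCarried hT hB' hw0 hf
      (fun X θ hθ A₀ e'' N ψ₀ hd hiso ↦ hone B'.dim p (by omega) (two_le_dim_of_isWeilTypeCM hB' (by omega)) X θ hθ A₀ e'' N ψ₀ hd hiso) hw
  exact map_mem_algebraicClasses_of_abelianVariety hB B' g.hom.hom.hom hw_alg

/-- **`HC_AV` with `HC_CM` IDLE, from CM-algebraic carriers and ONE carried Weil class per tensor structure over one elliptic curve**: Lemme 6.3.1 ∧ the CM LINE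
fact ∧ the door for `𝒪` ∧ CM-algebraic carriers (`2 ≤ p`, `2p + 4 ≤ n`) ∧ `OneTensorWeilHodgeClassCarriers 𝒪 E₀` ⟹ `∀ A, HodgeConjectureFor A.dim A.X`.
[cite: Andre1996Motifs, §6.3 Lemmes 6.3.1–6.3.3 (pp. 31–33)] [cite: Bloch1972Semiregularity, Remark (7.5)] -/
theorem forall_hodgeConjectureFor_of_andre1996_of_weilLinePencils_of_door_of_cmAlgebraic_of_oneCarried (h₂₁ : andre1996_cmAnchoredPencil)
    (h₂₂ : andre1996_cmHodgeClasses_weilLinePencils) (hT : LocalVariationalHodgeFor 𝒪)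
    (hcm : ∀ n p : ℕ, 2 ≤ p → 2 * p + 4 ≤ n → AnchoredCarrierAt 𝒪 n p
      (fun X θ ↦ (∃ A₀ : AbelianVariety ℂ, A₀.dim = n ∧ IsOfCMType A₀ ∧ Nonempty (A₀.X ≅ X)) ∧ IsPolarizationClass n X θ)
      (fun X _ ↦ (algebraicClasses X p : Set (complexBetti X (2 * p)))))
    {E₀ : AbelianVariety ℂ} (hE₀ : E₀.dim = 1) (hone : OneTensorWeilHodgeClassCarriers 𝒪 E₀) :
    ∀ A : AbelianVariety ℂ, HodgeConjectureFor A.dim A.X :=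
  forall_hodgeConjectureFor_of_cmAnchoredPencil_of_cmHodge_of_cmAlgebraicCarrierAt h₂₁ hT
    (cmHodgeHypothesisAt_of_weilLinePencils_of_door_of_oneTensorWeilHodgeClassCarriers h₂₂ hT hE₀ hone) hcm

end FromNode

end Summit.HodgeConjecture.HodgeConjecture.Ring2.SemiregularRepresentatives

end
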